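import Summits.CriticalPhenomena.CardyFormulaZ2.Theorems.CardyComplexConeParafermionToSLESixFamiliesDiamondIdentifyTilted
import Summits.CriticalPhenomena.CardyFormulaZ2.Theorems.CardyComplexConeParafermionToSLESixFamiliesDiamondExactPair
import Literature.Probability.LatticeModels.MeshDomainBulk
import Literature.Probability.LatticeModels.InterfaceSLETightness
import Mathlib.Analysis.Convex.Measure
import HarnessLib

/-!
# Line `potential-darboux-picard-diamond`, stub S4′ (`stub_identifyPotentialPh`): the discrete domain of a marked diamond

Helper file of the stub `stub_identifyPotentialPh` of crux `ParafermionToSLESixFamilies` (stmt-CriticalPhenomena-11389).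
Every use of S1′/S3 in the identification goes through the CELLS of the data `Λ δ` of an admissible family of a marked
diamond (`IsCell`: inner faces with a corner off both discrete arcs) and their centres: Arzelà–Ascoli needs the cells to
be dense in the closed diamond, "DIR in the limit" needs side cells all along each boundary segment. The discrete domain
`Ω_δ = meshDomain D.carrier δ` is "the largest mesh component", so the first task is to identify it. This file proves the
lattice bookkeeping (the "L" input flagged by the S3 worker):

* `eventually_mem_meshDomain_of_isMarkedDiamond` (registered helper of the crux item) — for all small `δ`, EVERY lattice
  point whose mesh point lies in the open diamond belongs to `Ω_δ`: from any such point a lattice walk moving both tilted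
  coordinates towards the centre stays inside the (convex) diamond and reaches the shrunken closed diamond `K`, whose
  lattice points lie in the bulk component (`eventually_mem_meshDomain_of_reachable` of `MeshDomainBulk`, the frontier of
  the convex carrier being Lebesgue-null);
* consequences for data `E` with `E.Ω = D.carrier`, `E.δ = δ` at such a mesh: a face is inner iff its four corners lie
  in the diamond (`isInnerFace_of_forall_corner_mem`, `corner_mem_of_isInnerFace`), a face one of whose corners has its
  whole `3 × 3` block of lattice neighbours inside is a cell (`isCell_of_block`), the centre of every cell lies in the
  diamond (`ctr_mem_carrier_of_isCell`), and the metric size of blocks and faces (`norm_meshPoint_sub_le_of_block`,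
  `norm_corner_sub_ctr_le`).
-/

noncomputable section

namespace Summit.CriticalPhenomena.CardyFormulaZ2.Cruxes.ParafermionToSLESixFamilies.PotentialDarbouxPicardDiamond

open scoped Topology
open Filter Set Metric Complex MeasureTheory
open Literature.Probability Literature.Probability.LatticeModels Literature.Probability.Percolation
open Literature.Probability.LatticeModels.DiscreteDobrushin
open Literature.Probability.RandomPlanarGeometry
open Summit.CriticalPhenomena.CardyFormulaZ2.Cruxes.EdgePrecompact.QkzStripBoundaryArm
  (not_mem_zdBoundary_of_forall_isInnerFace)

/-! ## Mesh points in tilted coordinates -/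

/-- The tilted coordinates of a mesh point: `re((δx − c)e) = (δ/√2)(x₀ + x₁) − (c.re + c.im)/√2`,
`im((δx − c)e) = (δ/√2)(x₁ − x₀) − (c.im − c.re)/√2`. -/
theorem tilt_meshPoint (δ : ℝ) (c : ℂ) (x : Site 2) :
    ((meshPoint δ x - c) * exp (-(Real.pi / 4 : ℝ) * I)).re =
        Real.sqrt 2 / 2 * δ * ((x 0 : ℝ) + x 1) - Real.sqrt 2 / 2 * (c.re + c.im) ∧
      ((meshPoint δ x - c) * exp (-(Real.pi / 4 : ℝ) * I)).im =
        Real.sqrt 2 / 2 * δ * ((x 1 : ℝ) - x 0) - Real.sqrt 2 / 2 * (c.im - c.re) := by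
  obtain ⟨h1, h2⟩ := re_im_mul_exp_neg_pi_div_four (meshPoint δ x - c)
  rw [h1, h2, sub_re, sub_im, meshPoint_re, meshPoint_im]
  constructor <;> ring

/-- The effect of a lattice move `u` on the tilted coordinates: `(δ/√2)(u₀ + u₁)` and `(δ/√2)(u₁ − u₀)`. -/
theorem tilt_meshPoint_add (δ : ℝ) (c : ℂ) (x u : Site 2) :
    ((meshPoint δ (x + u) - c) * exp (-(Real.pi / 4 : ℝ) * I)).re =
        ((meshPoint δ x - c) * exp (-(Real.pi / 4 : ℝ) * I)).re + Real.sqrt 2 / 2 * δ * ((u 0 : ℝ) + u 1) ∧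
      ((meshPoint δ (x + u) - c) * exp (-(Real.pi / 4 : ℝ) * I)).im =
        ((meshPoint δ x - c) * exp (-(Real.pi / 4 : ℝ) * I)).im + Real.sqrt 2 / 2 * δ * ((u 1 : ℝ) - u 0) := by
  obtain ⟨a1, a2⟩ := tilt_meshPoint δ c (x + u)
  obtain ⟨b1, b2⟩ := tilt_meshPoint δ c x
  rw [a1, a2, b1, b2]
  simp only [Pi.add_apply, Int.cast_add]
  constructor <;> ring

/-! ## One step of the centring walk -/

/-- `| |a| − h | < α` whenever `|a| < α` and `0 < h < α`. -/
theorem abs_abs_sub_lt {a h α : ℝ} (ha : |a| < α) (hh : 0 < h) (hhα : h < α) : |(|a| - h)| < α := by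
  rw [abs_lt]; constructor <;> linarith [abs_nonneg a]

/-- **One step towards the centre.** From a lattice point of the open diamond, one of the four lattice moves changes
both tilted coordinates `X, Y` into `±(|X| − h)`, `±(|Y| − h)` (`h = δ/√2`), hence stays in the diamond (`h < α, β`). -/
theorem exists_centring_step (δ : ℝ) (c : ℂ) (x : Site 2) :
    ∃ u : Site 2, (zdGraph 2).Adj x (x + u) ∧
      |((meshPoint δ (x + u) - c) * exp (-(Real.pi / 4 : ℝ) * I)).re| =
        |(|((meshPoint δ x - c) * exp (-(Real.pi / 4 : ℝ) * I)).re| - Real.sqrt 2 / 2 * δ)| ∧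
      |((meshPoint δ (x + u) - c) * exp (-(Real.pi / 4 : ℝ) * I)).im| =
        |(|((meshPoint δ x - c) * exp (-(Real.pi / 4 : ℝ) * I)).im| - Real.sqrt 2 / 2 * δ)| := by
  set X := ((meshPoint δ x - c) * exp (-(Real.pi / 4 : ℝ) * I)).re with hX
  set Y := ((meshPoint δ x - c) * exp (-(Real.pi / 4 : ℝ) * I)).im with hY
  set h := Real.sqrt 2 / 2 * δ
  have hadj : ∀ u : Site 2, (u = Pi.single 0 1 ∨ u = Pi.single 1 1 ∨ u = -Pi.single 0 1 ∨ u = -Pi.single 1 1) →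
      (zdGraph 2).Adj x (x + u) := by
    rintro u (rfl | rfl | rfl | rfl)
    · exact (zdGraph_adj_iff _ _).2 ⟨0, Or.inl rfl⟩
    · exact (zdGraph_adj_iff _ _).2 ⟨1, Or.inl rfl⟩
    · exact (zdGraph_adj_iff _ _).2 ⟨0, Or.inr (by simp)⟩
    · exact (zdGraph_adj_iff _ _).2 ⟨1, Or.inr (by simp)⟩
  have key : ∀ u : Site 2, ∀ s t : ℝ, ((u 0 : ℝ) + u 1 = s ∧ (u 1 : ℝ) - u 0 = t) →
      ((meshPoint δ (x + u) - c) * exp (-(Real.pi / 4 : ℝ) * I)).re = X + s * h ∧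
      ((meshPoint δ (x + u) - c) * exp (-(Real.pi / 4 : ℝ) * I)).im = Y + t * h := by
    rintro u s t ⟨hs, ht⟩
    obtain ⟨e1, e2⟩ := tilt_meshPoint_add δ c x u
    rw [e1, e2, hs, ht]
    constructor <;> ring
  -- sign choices: move `X` towards `0` (up if `X ≤ 0`), same for `Y`
  rcases le_or_gt X 0 with hX0 | hX0 <;> rcases le_or_gt Y 0 with hY0 | hY0
  · -- `X ≤ 0`, `Y ≤ 0`: move `(+h, +h)`, i.e. `u = e₁`
    refine ⟨Pi.single 1 1, hadj _ (Or.inr (Or.inl rfl)), ?_⟩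
    obtain ⟨e1, e2⟩ := key (Pi.single 1 1) 1 1 (by simp)
    rw [e1, e2, abs_of_nonpos hX0, abs_of_nonpos hY0]
    constructor
    · rw [show X + 1 * h = -(-X - h) by ring, abs_neg]
    · rw [show Y + 1 * h = -(-Y - h) by ring, abs_neg]
  · -- `X ≤ 0`, `Y > 0`: move `(+h, -h)`, i.e. `u = e₀`
    refine ⟨Pi.single 0 1, hadj _ (Or.inl rfl), ?_⟩
    obtain ⟨e1, e2⟩ := key (Pi.single 0 1) 1 (-1) (by simp)
    rw [e1, e2, abs_of_nonpos hX0, abs_of_pos hY0]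
    constructor
    · rw [show X + 1 * h = -(-X - h) by ring, abs_neg]
    · rw [show Y + -1 * h = Y - h by ring]
  · -- `X > 0`, `Y ≤ 0`: move `(-h, +h)`, i.e. `u = -e₀`
    refine ⟨-Pi.single 0 1, hadj _ (Or.inr (Or.inr (Or.inl rfl))), ?_⟩
    obtain ⟨e1, e2⟩ := key (-Pi.single 0 1) (-1) 1 (by simp)
    rw [e1, e2, abs_of_pos hX0, abs_of_nonpos hY0]
    constructor
    · rw [show X + -1 * h = X - h by ring]
    · rw [show Y + 1 * h = -(-Y - h) by ring, abs_neg]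
  · -- `X > 0`, `Y > 0`: move `(-h, -h)`, i.e. `u = -e₁`
    refine ⟨-Pi.single 1 1, hadj _ (Or.inr (Or.inr (Or.inr rfl))), ?_⟩
    obtain ⟨e1, e2⟩ := key (-Pi.single 1 1) (-1) (-1) (by simp)
    rw [e1, e2, abs_of_pos hX0, abs_of_pos hY0]
    constructor
    · rw [show X + -1 * h = X - h by ring]
    · rw [show Y + -1 * h = Y - h by ring]

/-! ## The centring walk -/

/-- Lattice neighbours with mesh points in a convex set are joined in its mesh graph. -/
theorem meshGraph_adj_of_convex {Ω : Set ℂ} (hΩ : Convex ℝ Ω) {δ : ℝ} {x y : Site 2} (hxy : (zdGraph 2).Adj x y)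
    (hx : meshPoint δ x ∈ Ω) (hy : meshPoint δ y ∈ Ω) : (meshGraph Ω δ).Adj x y :=
  meshGraph_adj_iff.2 ⟨hxy, (hΩ.segment_subset hx hy).trans subset_closure⟩

/-- Bookkeeping of the walk bound: one more step of size `h` (or a reflection inside `[0, h]`). -/
theorem walk_bound_step {b M h : ℝ} (n : ℕ) (hb0 : 0 ≤ b) (hb : b ≤ max (M - n * h) h) :
    |b - h| ≤ max (M - (n + 1 : ℕ) * h) h := by
  rcases le_or_gt b h with hbh | hbh
  · rw [abs_of_nonpos (by linarith)]
    exact le_trans (by linarith) (le_max_right _ _)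
  · rw [abs_of_pos (by linarith)]
    rcases le_max_iff.1 hb with h1 | h1
    · refine le_trans ?_ (le_max_left _ _)
      push_cast
      linarith
    · linarith

/-- **The centring walk.** In the open diamond `Ω = {|X| < α, |Y| < β}` (tilted coordinates about `c`), at a mesh `δ`
with `h = δ/√2 < α, β`, every lattice point `x` of `Ω` is joined inside the mesh vertex graph, in `n` steps, to a
lattice point `y` of `Ω` with `|X y| ≤ max (|X x| − n h) h` and `|Y y| ≤ max (|Y x| − n h) h`. -/
theorem exists_centring_walk (Ω : Set ℂ) (c : ℂ) {α β δ : ℝ}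
    (hΩ : Ω = {z : ℂ | |((z - c) * exp (-(Real.pi / 4 : ℝ) * I)).re| < α ∧
      |((z - c) * exp (-(Real.pi / 4 : ℝ) * I)).im| < β})
    (hδ : 0 < δ) (hhα : Real.sqrt 2 / 2 * δ < α) (hhβ : Real.sqrt 2 / 2 * δ < β) (n : ℕ) :
    ∀ (x : Site 2) (hx : x ∈ meshVertices Ω δ), ∃ (y : Site 2) (hy : y ∈ meshVertices Ω δ),
      (meshVertexGraph Ω δ).Reachable ⟨x, hx⟩ ⟨y, hy⟩ ∧
        |((meshPoint δ y - c) * exp (-(Real.pi / 4 : ℝ) * I)).re| ≤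
          max (|((meshPoint δ x - c) * exp (-(Real.pi / 4 : ℝ) * I)).re| - n * (Real.sqrt 2 / 2 * δ))
            (Real.sqrt 2 / 2 * δ) ∧
        |((meshPoint δ y - c) * exp (-(Real.pi / 4 : ℝ) * I)).im| ≤
          max (|((meshPoint δ x - c) * exp (-(Real.pi / 4 : ℝ) * I)).im| - n * (Real.sqrt 2 / 2 * δ))
            (Real.sqrt 2 / 2 * δ) := by
  have hpos : 0 < Real.sqrt 2 / 2 * δ := by positivity
  have hconv : Convex ℝ Ω := by rw [hΩ]; exact convex_tiltedBox c _ α β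
  have hmem : ∀ y : Site 2, y ∈ meshVertices Ω δ ↔
      |((meshPoint δ y - c) * exp (-(Real.pi / 4 : ℝ) * I)).re| < α ∧
        |((meshPoint δ y - c) * exp (-(Real.pi / 4 : ℝ) * I)).im| < β := fun y => by
    rw [mem_meshVertices_iff, hΩ]; rfl
  induction n with
  | zero =>
    intro x hx
    exact ⟨x, hx, SimpleGraph.Reachable.refl _, by simp, by simp⟩
  | succ n ih =>
    intro x hx
    obtain ⟨y, hy, hreach, hbX, hbY⟩ := ih x hx
    obtain ⟨u, hadj, huX, huY⟩ := exists_centring_step δ c y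
    have hyΩ := (hmem y).1 hy
    have hy' : y + u ∈ meshVertices Ω δ := by
      rw [hmem, huX, huY]
      exact ⟨abs_abs_sub_lt hyΩ.1 hpos hhα, abs_abs_sub_lt hyΩ.2 hpos hhβ⟩
    refine ⟨y + u, hy', hreach.trans (SimpleGraph.Adj.reachable ?_), ?_, ?_⟩
    · exact SimpleGraph.induce_adj.2 (meshGraph_adj_of_convex hconv hadj hy hy')
    · rw [huX]; exact walk_bound_step n (abs_nonneg _) hbX
    · rw [huY]; exact walk_bound_step n (abs_nonneg _) hbY

/-! ## The discrete domain of a marked diamond is everything -/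

/-- **For all small meshes, every lattice point of the open diamond belongs to the discrete domain `Ω_δ`.** -/
theorem eventually_mem_meshDomain_of_isMarkedDiamond : ∀ (D : DobrushinDomain), IsMarkedDiamond D → ∀ᶠ δ in 𝓝[>] (0:ℝ), ∀ x : Site 2, meshPoint δ x ∈ D.carrier → x ∈ meshDomain D.carrier δ := by
  intro D hD
  obtain ⟨c, α, β, hα, hβ, hcar⟩ := hD
  have he1 : ‖exp (-(Real.pi / 4 : ℝ) * I)‖ = 1 := norm_exp_neg_pi_div_four_mul_I
  -- the shrunken closed diamond `K`, a compact subset of the carrier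
  have hm : 0 < min α β := lt_min hα hβ
  obtain ⟨ρ, hρ0, hρα, hρβ⟩ : ∃ ρ : ℝ, 0 < ρ ∧ ρ ≤ α / 2 ∧ ρ ≤ β / 2 :=
    ⟨min α β / 2, by positivity, by linarith [min_le_left α β], by linarith [min_le_right α β]⟩
  set K : Set ℂ := {z : ℂ | |((z - c) * exp (-(Real.pi / 4 : ℝ) * I)).re| ≤ α - ρ ∧
    |((z - c) * exp (-(Real.pi / 4 : ℝ) * I)).im| ≤ β - ρ} with hK
  have hKc : IsCompact K := isCompact_tiltedClosedBox c _ he1 _ _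
  have hKD : K ⊆ D.carrier := by
    intro z hz
    rw [hcar]
    exact ⟨lt_of_le_of_lt hz.1 (by linarith), lt_of_le_of_lt hz.2 (by linarith)⟩
  have hconv : Convex ℝ D.carrier := by rw [hcar]; exact convex_tiltedBox c _ α β
  have hfr : volume (frontier D.carrier) = 0 := hconv.addHaar_frontier volume
  have hbulk := eventually_mem_meshDomain_of_reachable D.isOpen D.isBounded D.isConnected hfr hKc hKD
  have hsmall : ∀ᶠ δ in 𝓝[>] (0:ℝ), 0 < δ ∧ δ < ρ := by
    filter_upwards [Ioo_mem_nhdsGT hρ0] with δ hδ using hδ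
  filter_upwards [hbulk, hsmall] with δ hbδ hδ x hx
  obtain ⟨hδ0, hδρ⟩ := hδ
  have hs2 : Real.sqrt 2 / 2 < 1 := by
    rw [div_lt_one two_pos, Real.sqrt_lt' two_pos]; norm_num
  have hhδ : Real.sqrt 2 / 2 * δ < δ := by nlinarith
  have hhpos : 0 < Real.sqrt 2 / 2 * δ := by positivity
  have hhα : Real.sqrt 2 / 2 * δ < α := by linarith
  have hhβ : Real.sqrt 2 / 2 * δ < β := by linarith
  -- walk `n` steps towards the centre, `n h ≥ α + β`
  obtain ⟨n, hn⟩ : ∃ n : ℕ, (α + β) / (Real.sqrt 2 / 2 * δ) ≤ n := exists_nat_ge _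
  have hnh : α + β ≤ n * (Real.sqrt 2 / 2 * δ) := by rwa [div_le_iff₀ hhpos] at hn
  have hxV : x ∈ meshVertices D.carrier δ := hx
  have hxin : |((meshPoint δ x - c) * exp (-(Real.pi / 4 : ℝ) * I)).re| < α ∧
      |((meshPoint δ x - c) * exp (-(Real.pi / 4 : ℝ) * I)).im| < β := by
    have := hx; rw [hcar] at this; exact this
  obtain ⟨y, hy, hreach, hbX, hbY⟩ := exists_centring_walk D.carrier c hcar hδ0 hhα hhβ n x hxV
  -- the endpoint lies in `K`
  have hyK : meshPoint δ y ∈ K := by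
    have h0X := abs_nonneg ((meshPoint δ x - c) * exp (-(Real.pi / 4 : ℝ) * I)).re
    have h0Y := abs_nonneg ((meshPoint δ x - c) * exp (-(Real.pi / 4 : ℝ) * I)).im
    constructor
    · refine hbX.trans (max_le ?_ ?_) <;> linarith [hxin.1]
    · refine hbY.trans (max_le ?_ ?_) <;> linarith [hxin.2]
  -- hence `x`, joined to it, lies in the bulk component
  exact hbδ y x hy hxV hyK hreach.symm

/-! ## Inner faces and cells of data on a marked diamond -/

/-- Two corners of a face differ by at most one in each coordinate. -/
theorem abs_sub_le_one_of_isCorner {v w f : Site 2} (hv : IsCorner v f) (hw : IsCorner w f) (i : Fin 2) :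
    |w i - v i| ≤ 1 := by
  rcases hv i with h1 | h1 <;> rcases hw i with h2 | h2 <;> rw [h1, h2, abs_le] <;> constructor <;> linarith

/-- At a mesh where every lattice point of the (convex) carrier belongs to `Ω_δ`, a face whose four corners have mesh
points in the carrier is an inner face of any data `E` with `E.Ω = D.carrier`, `E.δ = δ`. -/
theorem isInnerFace_of_forall_corner_mem {Ω : Set ℂ} (hconv : Convex ℝ Ω) {δ : ℝ}
    (hgood : ∀ x : Site 2, meshPoint δ x ∈ Ω → x ∈ meshDomain Ω δ) {E : DiscreteDobrushin} (hΩ : E.Ω = Ω)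
    (hδ : E.δ = δ) {f : Site 2} (hf : ∀ v, IsCorner v f → meshPoint δ v ∈ Ω) : E.IsInnerFace f := by
  intro v w hv hw hadj
  rw [hΩ, hδ, discreteDomainGraph_adj_iff]
  exact ⟨meshGraph_adj_of_convex hconv hadj (hf v hv) (hf w hw), hgood v (hf v hv), hgood w (hf w hw)⟩

/-- Conversely, every corner of an inner face has its mesh point in the carrier. -/
theorem corner_mem_of_isInnerFace {E : DiscreteDobrushin} {f v : Site 2} (hf : E.IsInnerFace f) (hv : IsCorner v f) :
    meshPoint E.δ v ∈ E.Ω := by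
  obtain ⟨k, rfl⟩ := exists_faceAt_of_isCorner hv
  have hadj := adj_of_isInnerFace_faceAt (k := k) hf (Or.inl rfl)
  exact meshDomain_subset_meshVertices _ _ (discreteDomainGraph_adj_iff.1 hadj).2.1

/-- **Cells from blocks.** At a mesh where every lattice point of the convex carrier belongs to `Ω_δ`: if `v` is a
corner of the face `f` and the whole `3 × 3` block of lattice points around `v` has mesh points in the carrier, then `f`
is a cell of any data `E` with `E.Ω = D.carrier`, `E.δ = δ` (all four faces at `v` are inner, so `v` is off the discrete
boundary, hence off both discrete arcs). -/
theorem isCell_of_block {Ω : Set ℂ} (hconv : Convex ℝ Ω) {δ : ℝ}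
    (hgood : ∀ x : Site 2, meshPoint δ x ∈ Ω → x ∈ meshDomain Ω δ) {E : DiscreteDobrushin} (hΩ : E.Ω = Ω)
    (hδ : E.δ = δ) {f v : Site 2} (hv : IsCorner v f)
    (hblock : ∀ y : Site 2, (∀ i, |y i - v i| ≤ 1) → meshPoint δ y ∈ Ω) : IsCell E f := by
  have hfaces : ∀ k : Fin 4, E.IsInnerFace (faceAt v k) := fun k =>
    isInnerFace_of_forall_corner_mem hconv hgood hΩ hδ fun w hw =>
      hblock w (abs_sub_le_one_of_isCorner (isCorner_faceAt v k) hw)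
  have hvb : v ∉ E.zdBoundary := not_mem_zdBoundary_of_forall_isInnerFace hfaces
  obtain ⟨k, rfl⟩ := exists_faceAt_of_isCorner hv
  exact ⟨hfaces k, v, hv, fun h => hvb (E.zdArcA_subset_zdBoundary h), fun h => hvb (E.zdArcB_subset_zdBoundary h)⟩

/-- The `3 × 3` block: `|yᵢ − vᵢ| ≤ 1` forces `‖δy − δv‖ ≤ √2 δ`. -/
theorem norm_meshPoint_sub_le_of_block {δ : ℝ} (hδ : 0 ≤ δ) {y v : Site 2} (h : ∀ i, |y i - v i| ≤ 1) :
    ‖meshPoint δ y - meshPoint δ v‖ ≤ Real.sqrt 2 * δ := by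
  have h0 : |((y 0 : ℝ) - v 0)| ≤ 1 := by rw [← Int.cast_sub, ← Int.cast_abs]; exact_mod_cast h 0
  have h1 : |((y 1 : ℝ) - v 1)| ≤ 1 := by rw [← Int.cast_sub, ← Int.cast_abs]; exact_mod_cast h 1
  have hre : (meshPoint δ y - meshPoint δ v).re = δ * ((y 0 : ℝ) - v 0) := by
    rw [sub_re, meshPoint_re, meshPoint_re]; ring
  have him : (meshPoint δ y - meshPoint δ v).im = δ * ((y 1 : ℝ) - v 1) := by
    rw [sub_im, meshPoint_im, meshPoint_im]; ring
  have hsq : ‖meshPoint δ y - meshPoint δ v‖ ^ 2 ≤ (Real.sqrt 2 * δ) ^ 2 := by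
    rw [Complex.sq_norm, normSq_apply, hre, him, mul_pow, Real.sq_sqrt (by norm_num : (0:ℝ) ≤ 2)]
    have e0 : ((y 0 : ℝ) - v 0) ^ 2 ≤ 1 := by rw [← sq_abs]; nlinarith [abs_nonneg ((y 0 : ℝ) - v 0)]
    have e1 : ((y 1 : ℝ) - v 1) ^ 2 ≤ 1 := by rw [← sq_abs]; nlinarith [abs_nonneg ((y 1 : ℝ) - v 1)]
    nlinarith [sq_nonneg δ]
  exact (pow_le_pow_iff_left₀ (norm_nonneg _) (by positivity) two_ne_zero).1 hsq

/-- A corner of a face is at distance `≤ (√2/2) δ` from its centre. -/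
theorem norm_corner_sub_ctr_le {δ : ℝ} (hδ : 0 ≤ δ) {v x : Site 2} (hv : IsCorner v x) :
    ‖meshPoint δ v - ctr δ x‖ ≤ Real.sqrt 2 / 2 * δ := by
  have hre : (meshPoint δ v - ctr δ x).re = δ * ((v 0 : ℝ) - x 0 - 1 / 2) := by
    rw [ctr, sub_re, add_re, meshPoint_re, meshPoint_re]; simp; ring
  have him : (meshPoint δ v - ctr δ x).im = δ * ((v 1 : ℝ) - x 1 - 1 / 2) := by
    rw [ctr, sub_im, add_im, meshPoint_im, meshPoint_im]; simp; ring
  have e0 : ((v 0 : ℝ) - x 0 - 1 / 2) ^ 2 = 1 / 4 := by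
    rcases hv 0 with h | h <;> rw [h] <;> push_cast <;> ring
  have e1 : ((v 1 : ℝ) - x 1 - 1 / 2) ^ 2 = 1 / 4 := by
    rcases hv 1 with h | h <;> rw [h] <;> push_cast <;> ring
  have hsq : ‖meshPoint δ v - ctr δ x‖ ^ 2 ≤ (Real.sqrt 2 / 2 * δ) ^ 2 := by
    rw [Complex.sq_norm, normSq_apply, ← sq, ← sq, hre, him, mul_pow, mul_pow, e0, e1]
    have : (Real.sqrt 2 / 2 * δ) ^ 2 = δ ^ 2 / 2 := by
      rw [mul_pow, div_pow, Real.sq_sqrt (by norm_num : (0:ℝ) ≤ 2)]; ring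
    rw [this]
    nlinarith [sq_nonneg δ]
  exact (pow_le_pow_iff_left₀ (norm_nonneg _) (by positivity) two_ne_zero).1 hsq

/-- The centre of a face is the midpoint of its lower-left and upper-right corners. -/
theorem ctr_eq_midpoint (δ : ℝ) (f : Site 2) :
    ctr δ f = (1 / 2 : ℝ) • meshPoint δ f + (1 / 2 : ℝ) • meshPoint δ (f + Pi.single 0 1 + Pi.single 1 1) := by
  rw [meshPoint_add, meshPoint_add]
  have h0 : meshPoint δ (Pi.single 0 1 : Site 2) = (δ : ℂ) := by
    apply Complex.ext <;> simp [meshPoint_re, meshPoint_im]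
  have h1 : meshPoint δ (Pi.single 1 1 : Site 2) = (δ : ℂ) * I := by
    apply Complex.ext <;> simp [meshPoint_re, meshPoint_im]
  rw [h0, h1, ctr, real_smul, real_smul]
  push_cast
  ring

/-- **The centre of a cell lies in the (convex) carrier**, for data `E` with convex `E.Ω` read at its own mesh. -/
theorem ctr_mem_carrier_of_isCell {E : DiscreteDobrushin} (hconv : Convex ℝ E.Ω) {f : Site 2} (hf : IsCell E f) :
    ctr E.δ f ∈ E.Ω := by
  have hc : IsCorner (f + Pi.single 0 1 + Pi.single 1 1) f := fun j => by fin_cases j <;> simp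
  rw [ctr_eq_midpoint]
  exact hconv (corner_mem_of_isInnerFace hf.1 (isCorner_self f)) (corner_mem_of_isInnerFace hf.1 hc)
    (by norm_num) (by norm_num) (by norm_num)

end Summit.CriticalPhenomena.CardyFormulaZ2.Cruxes.ParafermionToSLESixFamilies.PotentialDarbouxPicardDiamond

end
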